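import Summits.CriticalPhenomena.PercolationContinuityZ3.Theorems.PercTorusSliceFillingSliceFillingUpperBoundWindow

/-!
# `SliceFillingUpperBound`, part 2: confinement of the periodic lift, box-hulls, and the
# pull-back of a product Bernoulli measure
(route PercTorusSliceFilling, item stmt-CriticalPhenomena-5416, helper file 2/3)

Continuation of `PercTorusSliceFillingSliceFillingUpperBoundWindow.lean` (same conventions: the
projection `π z = x + (z mod n)` is a variable with its defining equation; boxes are
`Set.Icc b.1 b.2`).  For a torus configuration `ω ⊆ Sym2 ((ℤ/nℤ)^d)` its PERIODIC LIFT is the set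
`{e ∈ E(ℤ^d) | Sym2.map π e ∈ ω}` of genuine lattice edges whose projection is open.

* `proj_mem_openCluster` — the lifted cluster of the origin projects into the torus cluster of `x`
  (`π` is a homomorphism of the open graphs);
* `confined` — if the torus cluster of `x` misses a slice `{y_i = t_i}` in every direction `i`,
  the lifted cluster of the origin lies in the open slab `r_i - n < z_i < r_i` where
  `r_i ∈ [1, n - 1]` represents `t_i - x_i` (discrete intermediate values along open lattice paths);
* `exists_hull_of_confined`, `hull_unique` — a set confined this way and containing the origin has
  a box-hull `b = (coordinatewise min, coordinatewise max)` with `b.1 ∈ [2 - n, 0]^d`,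
  `b.2 ∈ [0, n - 2]^d`, sides `b.2 i - b.1 i ≤ n - 2`; the hull is unique;
* `mem_boxes` — such `b` belongs to the finite index set
  `(Finset.Icc (2 - n) 0 ×ˢ Finset.Icc 0 (n - 2)).filter small`;
* `setBernoulli_map_pullback` — **pull-back of a product Bernoulli measure**: for a map `g`
  injective on `v` with `g '' v ⊆ u`, the image of `setBer(u, p)` under
  `t ↦ {i ∈ v | g i ∈ t}` is `setBer(v, p)` (checked on boxes, `Measure.eq_infinitePi`); this is
  the only measure theory of the coupling.

References: card
`Summits/CriticalPhenomena/PercolationContinuityZ3/Ideas/torus-slice-filling-identity-v2.md`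
(Lemma A); Grimmett, *Percolation* (1999) §1.3 (`P_p` is a product measure). Mathlib:
`ProbabilityTheory.setBernoulli_eq_map`, `MeasureTheory.Measure.eq_infinitePi`,
`MeasureTheory.Measure.infinitePi_pi`, `Set.exists_min_image`.
-/

noncomputable section

namespace Summit.CriticalPhenomena.PercolationContinuityZ3.Theorems

namespace SliceFilling

open MeasureTheory ProbabilityTheory unitInterval
open Literature.Probability.Percolation Literature.Probability.LatticeModels

variable {d n : ℕ}

/-! ### The periodic lift: projection and confinement -/

/-- The cluster of the origin in the periodic lift projects into the torus cluster of the base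
point `x`. -/
theorem proj_mem_openCluster [Fact (1 < n)] (x : TorusSite d n) (π : Site d → TorusSite d n)
    (hπ : ∀ z i, π z i = x i + ((z i : ℤ) : ZMod n)) (ω : Set (Sym2 (TorusSite d n)))
    {z : Site d} (hz : z ∈ openCluster {e ∈ (zdGraph d).edgeSet | Sym2.map π e ∈ ω} 0) :
    π z ∈ openCluster ω x := by
  have hom : ∀ u v, (openGraph {e ∈ (zdGraph d).edgeSet | Sym2.map π e ∈ ω}).Adj u v →
      (openGraph ω).Adj (π u) (π v) := by
    intro u v huv
    rw [openGraph_adj] at huv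
    obtain ⟨⟨he, hmem⟩, -⟩ := huv
    rw [Sym2.map_mk] at hmem
    rw [openGraph_adj]
    exact ⟨hmem, (torusGraph_adj_proj x π hπ ((SimpleGraph.mem_edgeSet _).1 he)).ne⟩
  let φ : openGraph {e ∈ (zdGraph d).edgeSet | Sym2.map π e ∈ ω} →g openGraph ω :=
    { toFun := π, map_rel' := fun {u v} h => hom u v h }
  have h := SimpleGraph.Reachable.map φ (show (openGraph _).Reachable 0 z from hz)
  have h' : (openGraph ω).Reachable (π 0) (π z) := h
  rwa [proj_zero x π hπ] at h'

/-- **Confinement.** If the torus cluster of `x` misses a slice in every direction, the lifted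
cluster of the origin lies in an open slab of width `n` around the origin in every coordinate:
there is `r ∈ [1, n - 1]^d` with `r i - n < z i < r i` for all its points `z`. -/
theorem confined (hn : 3 ≤ n) (x : TorusSite d n) (π : Site d → TorusSite d n)
    (hπ : ∀ z i, π z i = x i + ((z i : ℤ) : ZMod n)) (ω : Set (Sym2 (TorusSite d n)))
    (hω : ∀ i : Fin d, ∃ t : ZMod n, ∀ y ∈ openCluster ω x, y i ≠ t) :
    ∃ r : Fin d → ℤ, (∀ i, 1 ≤ r i ∧ r i ≤ (n : ℤ) - 1) ∧
      ∀ z ∈ openCluster {e ∈ (zdGraph d).edgeSet | Sym2.map π e ∈ ω} 0,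
        ∀ i, r i - n < z i ∧ z i < r i := by
  haveI : NeZero n := ⟨by omega⟩
  haveI : Fact (1 < n) := ⟨by omega⟩
  choose t ht using hω
  set r : Fin d → ℤ := fun i => ((t i - x i).val : ℤ) with hr
  have hrcast : ∀ i, ((r i : ℤ) : ZMod n) = t i - x i := fun i => by
    simp only [hr, Int.cast_natCast, ZMod.natCast_zmod_val]
  have hrn : ∀ i, (((r i - n : ℤ)) : ZMod n) = t i - x i := fun i => by
    rw [Int.cast_sub, hrcast, Int.cast_natCast, ZMod.natCast_self, sub_zero]
  have hrb : ∀ i, 1 ≤ r i ∧ r i ≤ (n : ℤ) - 1 := by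
    intro i
    have hne : t i - x i ≠ 0 := by
      intro h0
      exact ht i x (mem_openCluster_self ω x) (sub_eq_zero.1 h0).symm
    have hval : (t i - x i).val ≠ 0 := fun h0 => hne ((ZMod.val_eq_zero _).1 h0)
    have hlt := ZMod.val_lt (t i - x i)
    simp only [hr]
    constructor <;> omega
  refine ⟨r, hrb, ?_⟩
  have havoid : ∀ z ∈ openCluster {e ∈ (zdGraph d).edgeSet | Sym2.map π e ∈ ω} 0,
      ∀ i, z i ≠ r i ∧ z i ≠ r i - n := by
    intro z hz i
    have hti := ht i _ (proj_mem_openCluster x π hπ ω hz)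
    rw [hπ] at hti
    constructor
    · intro h
      apply hti
      rw [h, hrcast, add_sub_cancel]
    · intro h
      apply hti
      rw [h, hrn, add_sub_cancel]
  set S : Set (Site d) := {u | u ∈ openCluster {e ∈ (zdGraph d).edgeSet | Sym2.map π e ∈ ω} 0 ∧
    ∀ i, r i - n < u i ∧ u i < r i} with hS
  have hclosed : ∀ u v, u ∈ S →
      (openGraph {e ∈ (zdGraph d).edgeSet | Sym2.map π e ∈ ω}).Adj u v → v ∈ S := by
    rintro u v ⟨hu, hub⟩ huv
    have hv : v ∈ openCluster {e ∈ (zdGraph d).edgeSet | Sym2.map π e ∈ ω} 0 :=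
      SimpleGraph.Reachable.trans hu huv.reachable
    refine ⟨hv, fun i => ?_⟩
    rw [openGraph_adj] at huv
    have hadj : (zdGraph d).Adj u v := (SimpleGraph.mem_edgeSet _).1 huv.1.1
    obtain ⟨c1, c2⟩ := coord_sub_le_one_of_adj hadj i
    obtain ⟨a1, a2⟩ := havoid v hv i
    obtain ⟨b1, b2⟩ := hub i
    constructor <;> omega
  intro z hz
  have h0 : (0 : Site d) ∈ S := by
    refine ⟨mem_openCluster_self _ _, fun i => ?_⟩
    obtain ⟨b1, b2⟩ := hrb i
    simp only [Pi.zero_apply]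
    constructor <;> omega
  exact (mem_of_reachable_of_closed hclosed hz h0).2

/-! ### Box-hulls -/

/-- **Hull.** A set of sites containing the origin and confined to the open slabs
`r i - n < z i < r i`, `r ∈ [1, n - 1]^d`, has a box-hull `b` (coordinatewise minima and maxima):
`b.1 ∈ [2 - n, 0]^d`, `b.2 ∈ [0, n - 2]^d`, sides `≤ n - 2`, the set lies in the box and touches
all its faces. -/
theorem exists_hull_of_confined {C : Set (Site d)} (h0 : (0 : Site d) ∈ C) {r : Fin d → ℤ}
    (hr : ∀ i, 1 ≤ r i ∧ r i ≤ (n : ℤ) - 1) (hC : ∀ z ∈ C, ∀ i, r i - n < z i ∧ z i < r i) :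
    ∃ b : Site d × Site d,
      (∀ i, 2 - (n : ℤ) ≤ b.1 i ∧ b.1 i ≤ 0 ∧ 0 ≤ b.2 i ∧ b.2 i ≤ (n : ℤ) - 2) ∧
      (∀ i, b.2 i - b.1 i ≤ (n : ℤ) - 2) ∧
      C ⊆ Set.Icc b.1 b.2 ∧ ∀ i, (∃ z ∈ C, z i = b.1 i) ∧ ∃ z ∈ C, z i = b.2 i := by
  have hCfin : C.Finite := by
    refine (Set.finite_Icc (fun i => r i - n) r).subset ?_
    intro z hz
    exact ⟨fun i => (hC z hz i).1.le, fun i => (hC z hz i).2.le⟩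
  have hne : C.Nonempty := ⟨0, h0⟩
  have hmin : ∀ i : Fin d, ∃ z ∈ C, ∀ w ∈ C, z i ≤ w i := fun i =>
    Set.exists_min_image C (fun z => z i) hCfin hne
  have hmax : ∀ i : Fin d, ∃ z ∈ C, ∀ w ∈ C, w i ≤ z i := fun i =>
    Set.exists_max_image C (fun z => z i) hCfin hne
  choose zmin hzminC hzmin using hmin
  choose zmax hzmaxC hzmax using hmax
  refine ⟨(fun i => zmin i i, fun i => zmax i i), fun i => ?_, fun i => ?_, ?_, fun i => ?_⟩
  · have a1 := hzmin i 0 h0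
    have a2 := hzmax i 0 h0
    obtain ⟨a3, -⟩ := hC (zmin i) (hzminC i) i
    obtain ⟨-, a4⟩ := hC (zmax i) (hzmaxC i) i
    obtain ⟨a5, a6⟩ := hr i
    simp only [Pi.zero_apply] at a1 a2
    simp only
    refine ⟨?_, ?_, ?_, ?_⟩ <;> omega
  · obtain ⟨a3, -⟩ := hC (zmin i) (hzminC i) i
    obtain ⟨-, a4⟩ := hC (zmax i) (hzmaxC i) i
    simp only
    omega
  · intro z hz
    exact ⟨fun i => hzmin i z hz, fun i => hzmax i z hz⟩
  · exact ⟨⟨zmin i, hzminC i, rfl⟩, ⟨zmax i, hzmaxC i, rfl⟩⟩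

/-- The box-hull of a set is unique. -/
theorem hull_unique {C : Set (Site d)} {b b' : Site d × Site d}
    (h : C ⊆ Set.Icc b.1 b.2 ∧ ∀ i, (∃ z ∈ C, z i = b.1 i) ∧ ∃ z ∈ C, z i = b.2 i)
    (h' : C ⊆ Set.Icc b'.1 b'.2 ∧ ∀ i, (∃ z ∈ C, z i = b'.1 i) ∧ ∃ z ∈ C, z i = b'.2 i) :
    b = b' := by
  obtain ⟨hsub, hface⟩ := h
  obtain ⟨hsub', hface'⟩ := h'
  ext i
  · obtain ⟨z, hz, hzi⟩ := (hface i).1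
    obtain ⟨z', hz', hz'i⟩ := (hface' i).1
    have h1 : b'.1 i ≤ z i := (hsub' hz).1 i
    have h2 : b.1 i ≤ z' i := (hsub hz').1 i
    omega
  · obtain ⟨z, hz, hzi⟩ := (hface i).2
    obtain ⟨z', hz', hz'i⟩ := (hface' i).2
    have h1 : z i ≤ b'.2 i := (hsub' hz).2 i
    have h2 : z' i ≤ b.2 i := (hsub hz').2 i
    omega

/-- The finite index set of admissible boxes contains every hull produced by
`exists_hull_of_confined`. -/
theorem mem_boxes {b : Site d × Site d}
    (hb : ∀ i, 2 - (n : ℤ) ≤ b.1 i ∧ b.1 i ≤ 0 ∧ 0 ≤ b.2 i ∧ b.2 i ≤ (n : ℤ) - 2)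
    (hs : ∀ i, b.2 i - b.1 i ≤ (n : ℤ) - 2) :
    b ∈ (Finset.Icc (fun _ : Fin d => 2 - (n : ℤ)) 0 ×ˢ
      Finset.Icc 0 (fun _ : Fin d => (n : ℤ) - 2)).filter
        (fun b => ∀ i, b.2 i - b.1 i ≤ (n : ℤ) - 2) := by
  simp only [Finset.mem_filter, Finset.mem_product, Finset.mem_Icc]
  exact ⟨⟨⟨fun i => (hb i).1, fun i => (hb i).2.1⟩, fun i => (hb i).2.2.1, fun i => (hb i).2.2.2⟩,
    hs⟩

/-! ### Pull-back of a product Bernoulli measure -/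

/-- The local pull-back `t ↦ {i ∈ v | g i ∈ t}` is measurable. -/
theorem measurable_pullback {ι κ : Type*} (g : ι → κ) (v : Set ι) :
    Measurable fun t : Set κ => {i | i ∈ v ∧ g i ∈ t} :=
  measurable_set_iff.2 fun i => measurable_const.and (measurable_set_mem (g i))

/-- **Pull-back of a product Bernoulli measure.** If `g` is injective on `v` and maps `v` into
`u`, then the image of `setBer(u, p)` under `t ↦ {i ∈ v | g i ∈ t}` is `setBer(v, p)`: both are
product measures and they agree on boxes (`Measure.eq_infinitePi`). (Grimmett 1999 §1.3: `P_p` is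
a product measure.) -/
theorem setBernoulli_map_pullback {ι κ : Type*} (g : ι → κ) {v : Set ι} {u : Set κ}
    (hinj : Set.InjOn g v) (hsub : Set.MapsTo g v u) (p : unitInterval) :
    (setBer(u, p)).map (fun t : Set κ => {i | i ∈ v ∧ g i ∈ t}) = setBer(v, p) := by
  classical
  set κu : κ → Measure Prop := fun j =>
    toNNReal p • Measure.dirac (j ∈ u) + toNNReal (σ p) • Measure.dirac False with hκu
  set κv : ι → Measure Prop := fun i =>
    toNNReal p • Measure.dirac (i ∈ v) + toNNReal (σ p) • Measure.dirac False with hκv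
  set Φ : (κ → Prop) → (ι → Prop) := fun q i => i ∈ v ∧ q (g i) with hΦdef
  have hΦ : Measurable Φ :=
    measurable_pi_lambda _ fun i => measurable_const.and (measurable_pi_apply (g i))
  have hcomm : (fun t : Set κ => {i | i ∈ v ∧ g i ∈ t}) ∘ (fun q : κ → Prop => {j | q j}) =
      (fun q : ι → Prop => {i | q i}) ∘ Φ := by
    funext q; rfl
  rw [setBernoulli_eq_map, setBernoulli_eq_map,
    Measure.map_map (measurable_pullback g v) measurable_setOf, hcomm,
    ← Measure.map_map measurable_setOf hΦ]
  congr 1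
  refine Measure.eq_infinitePi κv fun s t ht => ?_
  rw [Measure.map_apply hΦ (MeasurableSet.pi s.countable_toSet fun i _ => ht i)]
  by_cases hB : ∀ i ∈ s, i ∉ v → False ∈ t i
  · -- coordinates of the box outside `v` impose no constraint
    set s' : Finset ι := s.filter (· ∈ v) with hs'
    set T : κ → Set Prop := fun j => {r | ∀ i ∈ s, i ∈ v → g i = j → r ∈ t i} with hT
    have hpre : Φ ⁻¹' Set.pi ↑s t = Set.pi ↑(s'.image g) T := by
      ext q
      simp only [Set.mem_preimage, Set.mem_pi, Finset.mem_coe, Finset.mem_image, hs',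
        Finset.mem_filter, hT, Set.mem_setOf_eq, forall_exists_index, and_imp]
      constructor
      · rintro h j i' - - rfl i hi hiv hgi
        have e : Φ q i = q (g i) := propext ⟨And.right, fun hr => ⟨hiv, hr⟩⟩
        have := h i hi
        rw [e, hgi] at this
        exact this
      · intro h i hi
        by_cases hiv : i ∈ v
        · have e : Φ q i = q (g i) := propext ⟨And.right, fun hr => ⟨hiv, hr⟩⟩
          rw [e]
          exact h (g i) i hi hiv rfl i hi hiv rfl
        · have e : Φ q i = False := propext ⟨fun hr => hiv hr.1, False.elim⟩
          rw [e]
          exact hB i hi hiv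
    rw [hpre, Measure.infinitePi_pi _ (fun j _ => MeasurableSet.of_discrete),
      Finset.prod_image (fun i hi i' hi' h => hinj (Finset.mem_filter.1 hi).2
        (Finset.mem_filter.1 hi').2 h)]
    rw [← Finset.prod_filter_mul_prod_filter_not s (· ∈ v)]
    have h1 : ∏ i ∈ s.filter (fun i => ¬ i ∈ v), κv i (t i) = 1 := by
      refine Finset.prod_eq_one fun i hi => ?_
      obtain ⟨his, hiv⟩ := Finset.mem_filter.1 hi
      have hF : False ∈ t i := hB i his hiv
      have e : (i ∈ v) = False := propext ⟨fun h => hiv h, False.elim⟩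
      simp only [hκv, e, Measure.add_apply, Measure.smul_apply, smul_eq_mul,
        Measure.dirac_apply_of_mem hF, mul_one, ENNReal.smul_def]
      rw [← ENNReal.coe_add, toNNReal_add_toNNReal_symm, ENNReal.coe_one]
    rw [h1, mul_one]
    refine Finset.prod_congr rfl fun i hi => ?_
    obtain ⟨his, hiv⟩ := Finset.mem_filter.1 hi
    have hTi : T (g i) = t i := by
      ext r
      simp only [hT, Set.mem_setOf_eq]
      constructor
      · intro h; exact h i his hiv rfl
      · intro hr i' hi' hi'v hg
        obtain rfl : i' = i := hinj hi'v hiv hg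
        exact hr
    have e1 : (g i ∈ u) = True := propext ⟨fun _ => trivial, fun _ => hsub hiv⟩
    have e2 : (i ∈ v) = True := propext ⟨fun _ => trivial, fun _ => hiv⟩
    simp only [hκv, hTi, e1, e2]
  · push Not at hB
    obtain ⟨i, hi, hiv, hFi⟩ := hB
    have hpre : Φ ⁻¹' Set.pi ↑s t = ∅ := by
      ext q
      simp only [Set.mem_preimage, Set.mem_pi, Finset.mem_coe, Set.mem_empty_iff_false,
        iff_false]
      intro h
      have e : Φ q i = False := propext ⟨fun hr => hiv hr.1, False.elim⟩
      have := h i hi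
      rw [e] at this
      exact hFi this
    rw [hpre, measure_empty]
    symm
    refine Finset.prod_eq_zero hi ?_
    have e : (i ∈ v) = False := propext ⟨fun h => hiv h, False.elim⟩
    simp only [hκv, e, Measure.add_apply, Measure.smul_apply, smul_eq_mul,
      Measure.dirac_apply, Set.indicator_of_notMem hFi, mul_zero, add_zero, ENNReal.smul_def]

end SliceFilling

end Summit.CriticalPhenomena.PercolationContinuityZ3.Theorems
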